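import Summits.Ventures.HodgeRepro2.T5SU11ResolventGroundStateWeight
import Summits.Ventures.HodgeRepro2.T5SU11SphericalXiLog

/-!
# The class at a rate `≥ 1` lies in the ground-state weighted space `W_1`

Row 556 shows `W_1 = {|g| ≤ D Ξ} ⊂ class` for every `λ > 1`. Conversely, a continuous source bounded on `(0, 1]` and
decaying like `e^{−εs}` with `ε ≥ 1` is dominated by `Ξ`, because `Ξ(s) ≥ (1 + s) e^{−s}/8` (row 4xx, `le_sph_one_hyp`):
on `(0, 1]` and on the compact middle range by boundedness, beyond by `e^{−εs} ≤ e^{−s} ≤ 8 Ξ(s)`.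

* `exists_le_mul_sph_one_of_class` — **every source of the class at a rate `ε ≥ 1` lies in `W_1`**: `∃ D, |g| ≤ D Ξ`;
* hence all the `W_1` results (rows 556–570) apply to such sources — in particular to the kernel sources
  `r ↦ K_{λ₂}(r, s)` of row 5xx, which decay at the rate `λ₂ > 1`.

Nothing is claimed about (N).

Blind lane: Mathlib + the HodgeRepro2 prefix only; no sorry; axioms ⊆ {propext, Classical.choice,
Quot.sound}.
-/

namespace Summit.Ventures.HodgeRepro2.T5SU11WeightedSpaceGroundStateClass

open Filter Topology MeasureTheory
open Set (Ioi Ioc Icc)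
open T5SU11Cartan T5SU11SphericalFunction T5SU11SphericalBounds T5SU11SphericalXiLog

section measure

variable [MeasurableSpace Circle] [BorelSpace Circle]

/-- `e^{−εs} ≤ 8 Ξ(s)` for `s ≥ 0` and `ε ≥ 1`. -/
theorem exp_neg_le_mul_sph_one {ε s : ℝ} (hε : 1 ≤ ε) (hs : 0 ≤ s) :
    Real.exp (-ε * s) ≤ 8 * sph 1 (hyp s) := by
  have h1 := le_sph_one_hyp hs
  have h2 : Real.exp (-ε * s) ≤ Real.exp (-s) := Real.exp_le_exp.mpr (by nlinarith)
  have h3 : Real.exp (-s) ≤ (1 + s) * Real.exp (-s) := by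
    have : 0 < Real.exp (-s) := Real.exp_pos _
    nlinarith
  nlinarith [h1, h2, h3]

/-- **THE CLASS AT A RATE `≥ 1` LIES IN `W_1`**: a continuous `g` on `(0, ∞)`, bounded by `M` on `(0, 1]`, with
`|g(s)| ≤ C e^{−εs}` for `s ≥ s₀` at a rate `ε ≥ 1`, satisfies `|g| ≤ D Ξ` on `(0, ∞)` for some `D ≥ 0`. -/
theorem exists_le_mul_sph_one_of_class {g : ℝ → ℝ} (hg : ContinuousOn g (Ioi 0))
    {M : ℝ} (hM : ∀ s ∈ Ioc (0 : ℝ) 1, |g s| ≤ M) {ε C s₀ : ℝ} (hε : 1 ≤ ε)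
    (hC : ∀ s, s₀ ≤ s → |g s| ≤ C * Real.exp (-ε * s)) :
    ∃ D : ℝ, 0 ≤ D ∧ ∀ s, 0 < s → |g s| ≤ D * sph 1 (hyp s) := by
  set T := max s₀ 1 with hT
  have hT1 : 1 ≤ T := le_max_right _ _
  -- the middle range `[1, T]` is compact and `g` is continuous there
  have hcompact : IsCompact (Icc (1 : ℝ) T) := isCompact_Icc
  have hsub : Icc (1 : ℝ) T ⊆ Ioi 0 := fun s hs => by
    have := hs.1
    exact Set.mem_Ioi.mpr (by linarith)
  obtain ⟨B, hB⟩ := hcompact.exists_bound_of_continuousOn (hg.mono hsub)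
  -- `Ξ ≥ (1 + s) e^{−s}/8 ≥ e^{−T}/8` on `(0, T]`
  have hΞlow : ∀ s, 0 < s → s ≤ T → Real.exp (-T) / 8 ≤ sph 1 (hyp s) := by
    intro s hs hsT
    have h1 := le_sph_one_hyp hs.le
    have h2 : Real.exp (-T) ≤ Real.exp (-s) := Real.exp_le_exp.mpr (by linarith)
    have h3 : Real.exp (-s) ≤ (1 + s) * Real.exp (-s) := by
      have : 0 < Real.exp (-s) := Real.exp_pos _
      nlinarith
    linarith
  have hC0 : 0 ≤ max C 0 := le_max_right _ _
  have hM0 : 0 ≤ max M 0 := le_max_right _ _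
  have hB0 : 0 ≤ max B 0 := le_max_right _ _
  have hexpT : 0 < Real.exp (-T) := Real.exp_pos _
  refine ⟨8 * Real.exp T * (max M 0 + max B 0) + 8 * max C 0, by positivity, fun s hs => ?_⟩
  have hΞ : 0 < sph 1 (hyp s) := sph_hyp_pos 1 s
  rcases le_or_gt s T with hsT | hsT
  · -- `s ≤ T`: `|g s| ≤ max M 0 + max B 0`, and `Ξ(s) ≥ e^{−T}/8`
    have hgs : |g s| ≤ max M 0 + max B 0 := by
      rcases le_or_gt s 1 with hs1 | hs1
      · have := hM s ⟨hs, hs1⟩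
        linarith [le_max_left M 0, le_max_left B 0, hB0]
      · have := hB s ⟨hs1.le, hsT⟩
        rw [Real.norm_eq_abs] at this
        linarith [le_max_left B 0, le_max_left M 0, hM0]
    have hΞs := hΞlow s hs hsT
    have hexpTT : Real.exp T * Real.exp (-T) = 1 := by rw [← Real.exp_add]; simp
    calc |g s| ≤ max M 0 + max B 0 := hgs
      _ = (8 * Real.exp T * (max M 0 + max B 0)) * (Real.exp (-T) / 8) := by
          rw [show (8 * Real.exp T * (max M 0 + max B 0)) * (Real.exp (-T) / 8)
            = (max M 0 + max B 0) * (Real.exp T * Real.exp (-T)) by ring, hexpTT, mul_one]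
      _ ≤ (8 * Real.exp T * (max M 0 + max B 0)) * sph 1 (hyp s) :=
          mul_le_mul_of_nonneg_left hΞs (by positivity)
      _ ≤ (8 * Real.exp T * (max M 0 + max B 0) + 8 * max C 0) * sph 1 (hyp s) := by
          apply mul_le_mul_of_nonneg_right _ hΞ.le
          linarith
  · -- `s > T ≥ s₀`: `|g s| ≤ C e^{−εs} ≤ 8 max(C, 0) Ξ(s)`
    have hs₀ : s₀ ≤ s := le_trans (le_max_left _ _) hsT.le
    have h1 := hC s hs₀
    have h2 := exp_neg_le_mul_sph_one hε hs.le
    have hexp : 0 ≤ Real.exp (-ε * s) := (Real.exp_pos _).le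
    calc |g s| ≤ C * Real.exp (-ε * s) := h1
      _ ≤ max C 0 * Real.exp (-ε * s) := mul_le_mul_of_nonneg_right (le_max_left _ _) hexp
      _ ≤ max C 0 * (8 * sph 1 (hyp s)) := mul_le_mul_of_nonneg_left h2 hC0
      _ ≤ (8 * Real.exp T * (max M 0 + max B 0) + 8 * max C 0) * sph 1 (hyp s) := by
          have : 0 ≤ 8 * Real.exp T * (max M 0 + max B 0) := by positivity
          nlinarith

end measure

end Summit.Ventures.HodgeRepro2.T5SU11WeightedSpaceGroundStateClass
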